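import Summits.ResolutionOfSingularities.ResolutionOfSingularities.Theorems.PAlterationPialtTameTransfer
import Summits.ResolutionOfSingularities.ResolutionOfSingularities.Theorems.PAlterationPialtTameNormalization
import Summits.ResolutionOfSingularities.ResolutionOfSingularities.Theorems.PAlterationPialtStubRRStability
import Summits.ResolutionOfSingularities.ResolutionOfSingularities.Theorems.PAlterationPialtStubReordering
import Summits.ResolutionOfSingularities.ResolutionOfSingularities.Theorems.PAlterationPialtNormalProjective
import HarnessLib

/-!
# `Pialt` (crux stmt-ResolutionOfSingularities-0555), line `SketchIdeator2` / Card A: transfer of tameness, III — descent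

Helper file for the OPEN stub `stub_tameResolution` (`TameResolution_p`) of the lead's skeleton
`radicially-regular-endgame` (`--supports stmt-ResolutionOfSingularities-0555`; it does not close
the item). Steps T4–T6 of `Cruxes/Pialt/STUB-PLAN-stub_tameResolution.md`.

Vocabulary (INLINED in the statements): RR / LRR / tame resolution as in
`PAlterationPialtTameTransfer.lean`.

* `tame_of_finite_universallyInjective_surjective` (T4, the workhorse) — **over a PERFECT field,
  tameness DESCENDS along finite radicial surjective covers onto NORMAL varieties**: for
  `g : X' → X` finite, universally injective, surjective, `X` normal, locally of finite type over
  a perfect field of characteristic `p`, a tame resolution of `X'` yields one of `X`. Frobenius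
  domination (`exists_frobeniusCover_of_finite_universallyInjective`) gives `N ≅ X` with a
  finite radicial surjective `ψ : N → X'`; pull the tame model `ρ' : Z' → X'` back along `ψ`
  and reduce: `P := (N ×_{X'} Z')_red` is integral, proper birational over `N`
  (`stub_reducedPullbackTransfer`) and a finite radicial cover of the normal LRR `Z'`, hence
  LRR (`stub_lrr_of_finite_universallyInjective`); normalise (`tame_of_lrr_modification`) and
  transport along `N ≅ X`.
* `tame_of_piAlteration` (T5) — **tameness descends along purely inseparable alterations of
  normal varieties over perfect fields**: Stein-factorise `ψ : Y → X` through the normalisation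
  `Y → Y'' → X` of `X` in `Y`; `Y → Y''` is proper birational (Zariski's Main Theorem), so
  `Y''` is tame (T1); `Y'' → X` is finite, radicial (normality of `X`), surjective, so `X` is
  tame (T4).
* `tame_of_forall_normal_isProjectiveOver` (T6) — **WLOG normal projective**: Chow's lemma,
  projective closure, normalisation (T1, T2).
-/

set_option linter.dupNamespace false -- mandated namespace of this single-conjunct summit

noncomputable section

open CategoryTheory CategoryTheory.Limits AlgebraicGeometry TopologicalSpace
open Literature.AlgebraicGeometry.Resolution Literature.AlgebraicGeometry.Motives
open Literature.AlgebraicGeometry.Motives.RatFn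
open Scheme.IdealSheafData

namespace Summit.ResolutionOfSingularities.ResolutionOfSingularities.Theorems.Pialt.RadiciallyRegular

/-! ## Descent along finite radicial covers onto normal varieties, perfect base field (T4) -/

/-- **Over a perfect field, tameness descends along finite radicial surjective covers onto
normal varieties.** Let `k` be perfect of characteristic `p`, `g : X' → X` finite, universally
injective and surjective between integral schemes, `X` normal and locally of finite type over
`k`. If `X'` has a tame resolution (proper birational `ρ' : Z' → X'`, `Z'` integral normal LRR),
so does `X`: Frobenius domination gives an integral `N ≅ X` with a finite radicial surjective
`ψ : N → X'`; the reduced fibre product `P := (N ×_{X'} Z')_red` is integral, proper and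
birational over `N`, and finite radicial surjective over the normal LRR `Z'`, hence LRR
(`stub_lrr_of_finite_universallyInjective`); its normalisation is a tame resolution of `N`
(`tame_of_lrr_modification`), transported along `N ≅ X`. [cite: Temkin2013, Rem. 1.3.5(i)] -/
theorem tame_of_finite_universallyInjective_surjective (p : ℕ) (hp : p.Prime) (k : Type)
    [Field k] [CharP k p] [PerfectField k] (X' X : Scheme.{0}) [IsIntegral X'] [IsIntegral X]
    (f : X ⟶ Spec (.of k)) [LocallyOfFiniteType f] (g : X' ⟶ X) [IsFinite g]
    [UniversallyInjective g] (hsurj : Function.Surjective g.base)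
    (hN : ∀ x : X, IsIntegrallyClosed (X.presheaf.stalk x))
    (h : ∃ (Z : Scheme.{0}) (π : Z ⟶ X'), IsProper π ∧ IsBirational π ∧ IsIntegral Z ∧
      (∀ z : Z, IsIntegrallyClosed (Z.presheaf.stalk z)) ∧
      ∀ z : Z, ∃ U : Z.Opens, z ∈ U ∧ ∃ (W : Scheme.{0}) (h : W ⟶ (U : Scheme.{0})),
        IsIntegral W ∧ Scheme.IsRegular W ∧ IsFinite h ∧ UniversallyInjective h ∧
          Function.Surjective h.base) :
    ∃ (Z : Scheme.{0}) (π : Z ⟶ X), IsProper π ∧ IsBirational π ∧ IsIntegral Z ∧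
      (∀ z : Z, IsIntegrallyClosed (Z.presheaf.stalk z)) ∧
      ∀ z : Z, ∃ U : Z.Opens, z ∈ U ∧ ∃ (W : Scheme.{0}) (h : W ⟶ (U : Scheme.{0})),
        IsIntegral W ∧ Scheme.IsRegular W ∧ IsFinite h ∧ UniversallyInjective h ∧
          Function.Surjective h.base := by
  haveI : IsDominant g := ⟨hsurj.denseRange⟩
  -- Frobenius domination: `N ≅ X` with `ψ : N → X'` finite, radicial, surjective
  obtain ⟨N, ψ, φ, hNint, hφ, hψfin, hψui, hψsurj⟩ :=
    exists_frobeniusCover_of_finite_universallyInjective hp k X' X f g hN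
  haveI := hNint
  haveI := hφ
  haveI := hψfin
  haveI := hψui
  haveI : Surjective ψ := ⟨hψsurj⟩
  -- a tame model `ρ' : Z' → X'`
  obtain ⟨Z', ρ', hρ'prop, hρ'bir, hZ'int, hZ'n, hZ'lrr⟩ := h
  haveI := hρ'prop
  haveI := hZ'int
  -- the reduced fibre product `P := (N ×_{X'} Z')_red`
  haveI hPint : IsIntegral (vanishingIdeal (⊤ : Closeds ↑(pullback ψ ρ'))).subscheme :=
    isIntegral_reduced_pullback ψ ρ'
  have hbirP : IsBirational
      ((vanishingIdeal (⊤ : Closeds ↑(pullback ψ ρ'))).subschemeι ≫ pullback.fst ψ ρ') :=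
    stub_reducedPullbackTransfer N X' Z' ψ ρ' hρ'bir
  haveI hfin₂ : IsFinite
      ((vanishingIdeal (⊤ : Closeds ↑(pullback ψ ρ'))).subschemeι ≫ pullback.snd ψ ρ') :=
    isFinite_reduced_pullback_snd ψ ρ'
  haveI hui₂ : UniversallyInjective
      ((vanishingIdeal (⊤ : Closeds ↑(pullback ψ ρ'))).subschemeι ≫ pullback.snd ψ ρ') :=
    universallyInjective_reduced_pullback_snd ψ ρ'
  have hsurj₂ : Surjective
      ((vanishingIdeal (⊤ : Closeds ↑(pullback ψ ρ'))).subschemeι ≫ pullback.snd ψ ρ') :=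
    surjective_reduced_pullback_snd ψ ρ'
  -- `P` is LRR: a finite radicial cover of the normal LRR `Z'` over the perfect `k`
  haveI : LocallyOfFiniteType (ρ' ≫ g ≫ f) := inferInstance
  have hPlrr := stub_lrr_of_finite_universallyInjective p hp k
    (vanishingIdeal (⊤ : Closeds ↑(pullback ψ ρ'))).subscheme Z' (ρ' ≫ g ≫ f)
    ((vanishingIdeal (⊤ : Closeds ↑(pullback ψ ρ'))).subschemeι ≫ pullback.snd ψ ρ')
    hsurj₂.surj hZ'n hZ'lrr
  -- normalise the LRR modification `P → N` and transport along `N ≅ X`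
  haveI : LocallyOfFiniteType
      (((vanishingIdeal (⊤ : Closeds ↑(pullback ψ ρ'))).subschemeι ≫ pullback.snd ψ ρ') ≫
        ρ' ≫ g ≫ f) := inferInstance
  haveI : IsProper
      ((vanishingIdeal (⊤ : Closeds ↑(pullback ψ ρ'))).subschemeι ≫ pullback.fst ψ ρ') :=
    inferInstance
  exact tame_of_iso φ (tame_of_lrr_modification k N
    (vanishingIdeal (⊤ : Closeds ↑(pullback ψ ρ'))).subscheme
    (((vanishingIdeal (⊤ : Closeds ↑(pullback ψ ρ'))).subschemeι ≫ pullback.snd ψ ρ') ≫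
      ρ' ≫ g ≫ f)
    ((vanishingIdeal (⊤ : Closeds ↑(pullback ψ ρ'))).subschemeι ≫ pullback.fst ψ ρ') hbirP hPlrr)

/-! ## Descent along purely inseparable alterations of normal varieties (T5) -/

/-- **Over a perfect field, tameness descends along purely inseparable alterations of normal
varieties.** Let `X` be a NORMAL integral separated scheme of finite type over a perfect field
`k` of characteristic `p`, and `ψ : Y → X` proper and surjective from an integral `Y`, finite and
universally injective over a dense open. If `Y` has a tame resolution, so does `X`: the
normalisation `Y'' := ψ.normalization` of `X` in `Y` receives the proper birational
`Y → Y''` (Zariski's Main Theorem, `isBirational_toNormalization`), so `Y''` is tame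
(`tame_of_isBirational`); and `Y'' → X` is finite (E. Noether), universally injective
(normality of `X`, pure inseparability of `K(Y)/K(X)`) and surjective, so `X` is tame
(`tame_of_finite_universallyInjective_surjective`). [cite: Temkin2013, Rem. 1.3.5(i)] -/
theorem tame_of_piAlteration (p : ℕ) (hp : p.Prime) (k : Type) [Field k] [CharP k p]
    [PerfectField k] (X : Scheme.{0}) (f : X ⟶ Spec (.of k)) [IsSeparated f]
    [LocallyOfFiniteType f] [QuasiCompact f] [IsIntegral X]
    (hN : ∀ x : X, IsIntegrallyClosed (X.presheaf.stalk x)) (Y : Scheme.{0}) [IsIntegral Y]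
    (ψ : Y ⟶ X) [IsProper ψ] (hsurj : Function.Surjective ψ.base)
    (hU : ∃ U : X.Opens, Dense (U : Set X) ∧ IsFinite (ψ ∣_ U) ∧ UniversallyInjective (ψ ∣_ U))
    (h : ∃ (Z : Scheme.{0}) (π : Z ⟶ Y), IsProper π ∧ IsBirational π ∧ IsIntegral Z ∧
      (∀ z : Z, IsIntegrallyClosed (Z.presheaf.stalk z)) ∧
      ∀ z : Z, ∃ U : Z.Opens, z ∈ U ∧ ∃ (W : Scheme.{0}) (h : W ⟶ (U : Scheme.{0})),
        IsIntegral W ∧ Scheme.IsRegular W ∧ IsFinite h ∧ UniversallyInjective h ∧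
          Function.Surjective h.base) :
    ∃ (Z : Scheme.{0}) (π : Z ⟶ X), IsProper π ∧ IsBirational π ∧ IsIntegral Z ∧
      (∀ z : Z, IsIntegrallyClosed (Z.presheaf.stalk z)) ∧
      ∀ z : Z, ∃ U : Z.Opens, z ∈ U ∧ ∃ (W : Scheme.{0}) (h : W ⟶ (U : Scheme.{0})),
        IsIntegral W ∧ Scheme.IsRegular W ∧ IsFinite h ∧ UniversallyInjective h ∧
          Function.Surjective h.base := by
  haveI : Fact p.Prime := ⟨hp⟩
  obtain ⟨U, hUd, hfinU, huiU⟩ := hU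
  haveI : IsDominant ψ := ⟨hsurj.denseRange⟩
  -- an affine open `V ⊆ U` of `X` containing the generic point
  have hξU : genericPoint X ∈ U :=
    ((genericPoint_spec X).mem_open_set_iff U.isOpen).mpr (by simpa using hUd.nonempty)
  obtain ⟨_, ⟨V, hVaff, rfl⟩, hξV, hVU⟩ :=
    X.isBasis_affineOpens.exists_subset_of_mem_open hξU U.isOpen
  haveI : IsFinite (ψ ∣_ V) := morphismRestrict_of_le ψ (P := @IsFinite) hVU hfinU
  haveI : UniversallyInjective (ψ ∣_ V) :=
    morphismRestrict_of_le ψ (P := @UniversallyInjective) hVU huiU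
  have hVaff' : IsAffineOpen (ψ ⁻¹ᵁ V) :=
    isAffineOpen_preimage_of_isAffineHom_morphismRestrict ψ hVaff
  have hfin : (ψ.app V).hom.Finite :=
    (IsFinite.SpecMap_iff _).mp
      ((morphismRestrict_iff_specMap_app ψ hVaff hVaff' (P := @IsFinite)).mp ‹_›)
  haveI : UniversallyInjective (Spec.map (ψ.app V)) :=
    (morphismRestrict_iff_specMap_app ψ hVaff hVaff' (P := @UniversallyInjective)).mp ‹_›
  -- the function field extension `K(Y)/K(X)` is finite and purely inseparable
  haveI : FiniteDimensional X.functionField (FunctionFieldOver ψ) :=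
    finiteDimensional_functionFieldOver_of_finite ψ hξV hVaff' hfin
  haveI : IsPurelyInseparable X.functionField (FunctionFieldOver ψ) :=
    isPurelyInseparable_functionFieldOver_of_universallyInjective ψ hξV hVaff'
  haveI : CharP X.functionField p := by
    let ι : k →+* X.functionField :=
      (X.presheaf.germ ⊤ (genericPoint X) trivial).hom.comp
        (f.appTop.hom.comp (Scheme.ΓSpecIso (.of k)).inv.hom)
    exact (ι.charP_iff_charP p).mp ‹_›
  -- the normalisation `Y'' := ψ.normalization` of `X` in `Y`: finite, radicial, surjective
  haveI hfinh : IsFinite ψ.fromNormalization :=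
    isFinite_fromNormalization_of_finiteDimensional ψ f
  haveI hui : UniversallyInjective ψ.fromNormalization :=
    universallyInjective_fromNormalization ψ hN p
  have hsurjh : Function.Surjective ψ.fromNormalization.base := by
    intro x
    obtain ⟨y, hy⟩ := hsurj x
    refine ⟨ψ.toNormalization.base y, ?_⟩
    change (ψ.toNormalization ≫ ψ.fromNormalization).base y = x
    rw [ψ.toNormalization_fromNormalization]
    exact hy
  have hne : ((ψ ⁻¹ᵁ V : Y.Opens) : Set Y).Nonempty :=
    ⟨genericPoint Y, genericPoint_mem_preimage ψ hξV⟩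
  -- `Y''` is tame: `Y → Y''` is proper birational (Zariski's Main Theorem)
  haveI := isProper_toNormalization ψ
  have hT : ∃ (Z : Scheme.{0}) (π : Z ⟶ ψ.normalization), IsProper π ∧ IsBirational π ∧
      IsIntegral Z ∧ (∀ z : Z, IsIntegrallyClosed (Z.presheaf.stalk z)) ∧
      ∀ z : Z, ∃ U : Z.Opens, z ∈ U ∧ ∃ (W : Scheme.{0}) (h : W ⟶ (U : Scheme.{0})),
        IsIntegral W ∧ Scheme.IsRegular W ∧ IsFinite h ∧ UniversallyInjective h ∧
          Function.Surjective h.base :=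
    tame_of_isBirational ψ.toNormalization (isBirational_toNormalization ψ V hne) h
  -- hence `X` is tame (T4)
  exact tame_of_finite_universallyInjective_surjective p hp k ψ.normalization X f
    ψ.fromNormalization hsurjh hN hT

/-! ## WLOG normal projective (T6) -/

/-- **Tameness for one variety follows from tameness of the normal projective varieties over
the same field.** Chow's lemma (`ChowLemmaIntegral_holds`) gives a proper birational
`π : X' → X` from an integral `X'` with a quasi-compact immersion `ι : X' → ℙⁿ_k`; the
scheme-theoretic image `X̄'` of `ι` is an integral projective variety containing `X'` as a
non-empty open; its normalisation `X̄'^ν` is normal, integral and projective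
(`isProjectiveOver_normalization`). A tame resolution of `X̄'^ν` descends along the proper
birational `X̄'^ν → X̄'` (`tame_of_isBirational`), restricts to `X'` (`tame_of_isOpenImmersion`)
and descends along `π`. [cite: DeJong1996, 4.6–4.7, 4.16] -/
theorem tame_of_forall_normal_isProjectiveOver {k : Type} [Field k] {X : Scheme.{0}}
    (f : X ⟶ Spec (.of k)) [IsSeparated f] [LocallyOfFiniteType f] [QuasiCompact f] [IsIntegral X]
    (H : ∀ (X' : Scheme.{0}) (f' : X' ⟶ Spec (.of k)), IsIntegral X' →
      Literature.AlgebraicGeometry.Motives.IsProjectiveOver (Over.mk f') →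
        (∀ x : X', IsIntegrallyClosed (X'.presheaf.stalk x)) →
          ∃ (Z : Scheme.{0}) (π : Z ⟶ X'), IsProper π ∧ IsBirational π ∧ IsIntegral Z ∧
            (∀ z : Z, IsIntegrallyClosed (Z.presheaf.stalk z)) ∧
            ∀ z : Z, ∃ U : Z.Opens, z ∈ U ∧ ∃ (W : Scheme.{0}) (h : W ⟶ (U : Scheme.{0})),
              IsIntegral W ∧ Scheme.IsRegular W ∧ IsFinite h ∧ UniversallyInjective h ∧
                Function.Surjective h.base) :
    ∃ (Z : Scheme.{0}) (π : Z ⟶ X), IsProper π ∧ IsBirational π ∧ IsIntegral Z ∧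
      (∀ z : Z, IsIntegrallyClosed (Z.presheaf.stalk z)) ∧
      ∀ z : Z, ∃ U : Z.Opens, z ∈ U ∧ ∃ (W : Scheme.{0}) (h : W ⟶ (U : Scheme.{0})),
        IsIntegral W ∧ Scheme.IsRegular W ∧ IsFinite h ∧ UniversallyInjective h ∧
          Function.Surjective h.base := by
  obtain ⟨n, X', π, ι, hX', hι, hπ, hsurj, hcomm, U, hU, hU', hiso⟩ :=
    ChowLemmaIntegral_holds.{0} k X f ‹_› ‹_› ‹_› ‹_›
  haveI := hX'
  haveI := hι
  haveI := hπ
  haveI := hsurj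
  haveI := hiso
  -- `π` is proper birational: descend along it
  refine tame_of_isBirational π ⟨U, hU, hU', hiso⟩ ?_
  -- the projective closure `X̄'` of `X'` in `ℙⁿ_k`
  let P := Literature.AlgebraicGeometry.Motives.projectiveSpace n k
  haveI : IsProper P.hom := Literature.AlgebraicGeometry.Motives.isProper_projectiveSpace n k
  haveI : QuasiCompact (ι ≫ P.hom) := by rw [hcomm]; infer_instance
  haveI : QuasiCompact ι := QuasiCompact.of_comp ι P.hom
  haveI : IsIntegral ι.image := ChowLemmaProof.isIntegral_image ι
  -- restrict a tame resolution of `X̄'` to the open `X'`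
  refine tame_of_isOpenImmersion ι.toImage ?_
  -- `X̄'` is tame: its normalisation is normal, integral and projective
  have hproj : Literature.AlgebraicGeometry.Motives.IsProjectiveOver (Over.mk (ι.imageι ≫ P.hom)) :=
    ⟨n, Over.homMk ι.imageι rfl, inferInstanceAs (IsClosedImmersion ι.imageι)⟩
  haveI : IsProper (ι.imageι ≫ P.hom) := Literature.AlgebraicGeometry.Motives.IsProjectiveOver.isProper hproj
  haveI : IsFinite (normalizationι ι.image) :=
    isFinite_normalizationι ι.image NoetherFiniteIntegralClosure_holds (ι.imageι ≫ P.hom)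
  refine tame_of_isBirational (normalizationι ι.image)
    (isBirational_normalizationι ι.image (ι.imageι ≫ P.hom)) ?_
  exact H (normalization ι.image) (normalizationι ι.image ≫ ι.imageι ≫ P.hom) inferInstance
    (isProjectiveOver_normalization ι.image (ι.imageι ≫ P.hom) hproj)
    (isIntegrallyClosed_stalk_normalization ι.image)

end Summit.ResolutionOfSingularities.ResolutionOfSingularities.Theorems.Pialt.RadiciallyRegular

end
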